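import Summits.Schanuel.Schanuel.Theorems.RootDecomp1BMovingZero03

/-!
# RootDecomp1BMovingZero — lens 4, generation 35/36 «AX-TRANSVERSAL MOVING ZERO»: T″ = `IsolatedIntersectionGeneral` PROVED modulo ONE print fact (`CurveSelection`) + the tree Ax statement, and SUB-PIECE A = `AnalyticMovingZero` PROVED modulo TWO print facts (`RoucheMaps`, `IsolatedZeroLowerBound`) — continuation (RootDecomp1BMovingZero04): §A the typing of SUB-PIECE A (`AnalyticMovingZero`, toy, `curveΦ`, `movingZero_theta`) + §A⁺ A PROVED mod `RoucheMaps` / `IsolatedZeroLowerBound` (`analyticMovingZero_of_facts`)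

(lens-4 g35 HOME kernels MovingZeroTpp.lean 6bf08f88…de4e (2338 l = §G03 MovingZeroGeneral03 b461aa70… + §E MovingZeroExpPoly fdd5ca6b… + §X MovingZeroAxGerms a74f0949… verbatim
bodies + NEW §T) and MovingZeroPieceA.lean 8899dedb…8da9 (238 l); ADDENDUM-2 L1857, writer re-check L1858, critic RULING L1859 (T″ VERIFIED and BOOKED; `CurveSelection`
ACCEPTED as THE ONE T-fact), RESULT/DONE L1865, critic RULING/ADDENDUM L1867 (A VERIFIED and BOOKED; `RoucheMaps` / `IsolatedZeroLowerBound` ACCEPTED AS TYPED),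
lens-4 g36 NOTE/CLAIM L1871 (PORT-READY) and critic ACK L1875 (PORT STAGING GO; credits T (L1859) and A (L1867) paid at the critic's verification of the
accepted parts carrying `isolatedIntersectionGeneral_of_curveSelection` resp. `analyticMovingZero_of_facts`); port by census-1 gen 17 as `RootDecomp1BMovingZero03`–`10`
PORT EDITS: the 44 `#guard_msgs in #print axioms` guards and their section headers dropped (HOME probes); `set_option linter.dupNamespace false` dropped; PieceA's
character-identical copy of `AnalyticMovingZero` dropped (§A's definition is used; its Facts + Proof sections follow §A in part 04); the four re-proved
`AxSchanuelTwoGerms` helpers (`exists_algDerivation_eq_derivative'`, `ofPowerSeries_taylor_exp_ne_zero'`, `algebraMap_eq_ofPowerSeries_C'`, `taylor_const'`) PRIVATE in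
part 08 (statement-twins of the unbuilt Literature module) with a notation-free private copy `taylor_const''` in part 09; `CurveSelection`'s docstring replaced by the
FACT (T-ii) text dictated in L1871 (ACK L1875); the three fact docstrings' cite KEYS normalised to references.bib (`Chirka1989`, `DAngeloSCV1993` — the gate's cite-key lint), locators unchanged; nine one-line docstrings added; statements and proofs otherwise verbatim; `AxRankBoundLaurent` stays a binder BY
NAME (discharge: HOME MovingZeroAxGermsTree.lean c3203867… once `AxSchanuelUniv` builds on the farm). `--supports stmt-Schanuel-32406`; no census credit carried;
rung 0 — nothing here proves Schanuel.)
-/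

noncomputable section

namespace Summit.Schanuel.Schanuel.Theorems.RootDecomp1BMovingZero

section G03part

open Complex Polynomial

open Summit.Schanuel.Schanuel.Theorems.RootDecomp1KHyper (LWMeasure)
open Summit.Schanuel.Schanuel.Theorems.RootDecomp1KHyper.HyperCell (ExplicitRatExpApprox)
open Summit.Schanuel.Schanuel.Theorems.RootDecomp1KGeneric (LiouvilleOrder)
open Summit.Schanuel.Schanuel.Theorems.RootDecomp1BFedFlagCore (polarDeg)

/-! ## §A  PROPOSED typing of M′'s ANALYTIC sub-piece A (critic VERDICT L1819 (δ)(M′-i)) — for g36.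
The glue `A ∧ B ∧ pinning ⟹ ApproxOfIsolated` is NOT built here (g36 work: analyticity of the curve pair near θ,
`IsolatedAt` ⟹ isolated zero, branch pinning (s-iii), q-bookkeeping); A is stated BASE-POINT- and FAMILY-general, as
pure several-complex-variables content: [corpus: book:chirkand-complex-analytic-sets p0124 §10.3 Thm 1] (Rouché for
holomorphic maps, whose printed proof contains the finiteness of the zero set in `D`) + a Łojasiewicz /
local-Nullstellensatz rate `‖Φ_{t₀}(z)‖ ≥ c ‖z − w₀‖^N`.  Toy instance PROVED both sides (hypotheses satisfiable,
conclusion true) on `Φ t (w₁, w₂) = (w₁ − t, w₂)`. -/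

section PieceA

open Filter Topology

/-- **SUB-PIECE A of M′ — `AnalyticMovingZero` (PROPOSED typing, OPEN, ATTACKABLE).**  An ISOLATED zero `w₀` of a
holomorphic map `Φ_{t₀} : ℂ² → ℂ²` in a holomorphic one-parameter family `Φ_t` MOVES: for `t` near `t₀` there is a
zero `w_t` of `Φ_t`, ISOLATED in `Z(Φ_t)`, with `‖w_t − w₀‖ ≤ C |t − t₀|^κ` (equidimensionality is essential — the
real family `x² + t` shows nothing like it holds for real-analytic maps). -/
def AnalyticMovingZero : Prop :=
  ∀ (Φ : ℂ → ℂ × ℂ → ℂ × ℂ) (t₀ : ℂ) (w₀ : ℂ × ℂ),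
    AnalyticAt ℂ (Function.uncurry Φ) (t₀, w₀) → Φ t₀ w₀ = 0 → (∀ᶠ w in 𝓝[≠] w₀, Φ t₀ w ≠ 0) →
      ∃ δ C κ : ℝ, 0 < δ ∧ 0 < C ∧ 0 < κ ∧ ∀ t : ℂ, ‖t - t₀‖ < δ →
        ∃ w : ℂ × ℂ, Φ t w = 0 ∧ (∀ᶠ w' in 𝓝[≠] w, Φ t w' ≠ 0) ∧ ‖w - w₀‖ ≤ C * ‖t - t₀‖ ^ κ

/-- The toy family `Φ t (w₁, w₂) = (w₁ − t, w₂)` (moving zero `w_t = (t, 0)`). -/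
def toyΦ : ℂ → ℂ × ℂ → ℂ × ℂ := fun t w => (w.1 - t, w.2)

/-- The HYPOTHESES of A are satisfiable (non-vacuity): `toyΦ` is analytic, `toyΦ 0 0 = 0`, `0` is an isolated zero. -/
theorem toyΦ_hypotheses : AnalyticAt ℂ (Function.uncurry toyΦ) (0, 0) ∧ toyΦ 0 0 = 0 ∧
    ∀ᶠ w in 𝓝[≠] (0 : ℂ × ℂ), toyΦ 0 w ≠ 0 := by
  refine ⟨?_, ?_, ?_⟩
  · show AnalyticAt ℂ (fun p : ℂ × (ℂ × ℂ) => (p.2.1 - p.1, p.2.2)) (0, 0)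
    exact ((analyticAt_fst.comp analyticAt_snd).sub analyticAt_fst).prod (analyticAt_snd.comp analyticAt_snd)
  · simp [toyΦ]
  · refine eventually_nhdsWithin_of_forall (fun w hw => ?_)
    intro h
    apply hw
    simp only [toyΦ, sub_zero, Prod.mk_eq_zero] at h
    exact Prod.ext h.1 h.2

/-- … and the CONCLUSION of A holds for it (`δ = C = κ = 1`, `w_t = (t, 0)`). -/
theorem toyΦ_conclusion : ∃ δ C κ : ℝ, 0 < δ ∧ 0 < C ∧ 0 < κ ∧ ∀ t : ℂ, ‖t - (0 : ℂ)‖ < δ →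
    ∃ w : ℂ × ℂ, toyΦ t w = 0 ∧ (∀ᶠ w' in 𝓝[≠] w, toyΦ t w' ≠ 0) ∧
      ‖w - (0 : ℂ × ℂ)‖ ≤ C * ‖t - (0 : ℂ)‖ ^ κ := by
  refine ⟨1, 1, 1, one_pos, one_pos, one_pos, fun t _ => ⟨(t, 0), ?_, ?_, ?_⟩⟩
  · simp [toyΦ]
  · refine eventually_nhdsWithin_of_forall (fun w hw => ?_)
    intro h
    apply hw
    simp only [toyΦ, Prod.mk_eq_zero, sub_eq_zero] at h
    exact Prod.ext h.1 h.2
  · rw [sub_zero, sub_zero, Real.rpow_one, one_mul, Prod.norm_def]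
    simp

/-- A applies to the toy (readback of the instantiation). -/
theorem analyticMovingZero_toy (hA : AnalyticMovingZero) : ∃ δ C κ : ℝ, 0 < δ ∧ 0 < C ∧ 0 < κ ∧
    ∀ t : ℂ, ‖t - (0 : ℂ)‖ < δ → ∃ w : ℂ × ℂ, toyΦ t w = 0 ∧ (∀ᶠ w' in 𝓝[≠] w, toyΦ t w' ≠ 0) ∧
      ‖w - (0 : ℂ × ℂ)‖ ≤ C * ‖t - (0 : ℂ)‖ ^ κ :=
  hA toyΦ 0 0 toyΦ_hypotheses.1 toyΦ_hypotheses.2.1 toyΦ_hypotheses.2.2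

/-! ### A at work on the curve pair (PROVED mod A): analyticity of the pair near a base point off the cut,
`IsolatedAt'` ⟹ isolated zero, and the MOVING ZERO at `θ = (e, e^i)` for every relation pair with an isolated
intersection — the analytic half of the glue `A ∧ B ∧ pinning ⟹ M′` (pinning, B and the q-bookkeeping remain). -/

/-- The curve-pair map of two coefficient families (principal branches):
`Φ_t(X, Y) = (Σ_k G₁ₖ(t,X,Y) (e^{t log X})^k, Σ_k G₂ₖ(t,X,Y) (e^{t log Y})^k)`. -/
def curveΦ {K₁ K₂ : ℕ} (G₁ : Fin (K₁ + 1) → MvPolynomial (Fin 3) ℤ) (G₂ : Fin (K₂ + 1) → MvPolynomial (Fin 3) ℤ) :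
    ℂ → ℂ × ℂ → ℂ × ℂ := fun t w =>
  (relEval G₁ t w.1 w.2 (cexp (t * Complex.log w.1)), relEval G₂ t w.1 w.2 (cexp (t * Complex.log w.2)))

/-- Each coordinate of `(t, w) ↦ ![t, w.1, w.2]` is analytic. -/
theorem analyticAt_vec3 (z : ℂ × (ℂ × ℂ)) (i : Fin 3) :
    AnalyticAt ℂ (fun p : ℂ × (ℂ × ℂ) => (![p.1, p.2.1, p.2.2] : Fin 3 → ℂ) i) z := by
  refine Fin.cases ?_ (fun j => ?_) i
  · simp only [Matrix.cons_val_zero]; exact analyticAt_fst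
  · refine Fin.cases ?_ (fun k => ?_) j
    · simp only [Matrix.cons_val_succ, Matrix.cons_val_zero]; exact analyticAt_fst.comp analyticAt_snd
    · refine Fin.cases ?_ (fun l => l.elim0) k
      simp only [Matrix.cons_val_succ, Matrix.cons_val_zero]; exact analyticAt_snd.comp analyticAt_snd

/-- `(t, X, Y) ↦ Σ_k G_k(t, X, Y) e^{k t log X}` is analytic where `X` is off the cut. -/
theorem analyticAt_relEval_fst {K : ℕ} (G : Fin (K + 1) → MvPolynomial (Fin 3) ℤ) {z : ℂ × (ℂ × ℂ)}
    (hz : z.2.1 ∈ Complex.slitPlane) :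
    AnalyticAt ℂ (fun p : ℂ × (ℂ × ℂ) => relEval G p.1 p.2.1 p.2.2 (cexp (p.1 * Complex.log p.2.1))) z := by
  unfold relEval
  refine Finset.analyticAt_fun_sum _ (fun k _ => ?_)
  exact (AnalyticAt.aeval_mvPolynomial (analyticAt_vec3 z) (G k)).mul
    ((analyticAt_fst.mul ((analyticAt_fst.comp analyticAt_snd).clog hz)).cexp'.pow _)

/-- `(t, X, Y) ↦ Σ_k G_k(t, X, Y) e^{k t log Y}` is analytic where `Y` is off the cut. -/
theorem analyticAt_relEval_snd {K : ℕ} (G : Fin (K + 1) → MvPolynomial (Fin 3) ℤ) {z : ℂ × (ℂ × ℂ)}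
    (hz : z.2.2 ∈ Complex.slitPlane) :
    AnalyticAt ℂ (fun p : ℂ × (ℂ × ℂ) => relEval G p.1 p.2.1 p.2.2 (cexp (p.1 * Complex.log p.2.2))) z := by
  unfold relEval
  refine Finset.analyticAt_fun_sum _ (fun k _ => ?_)
  exact (AnalyticAt.aeval_mvPolynomial (analyticAt_vec3 z) (G k)).mul
    ((analyticAt_fst.mul ((analyticAt_snd.comp analyticAt_snd).clog hz)).cexp'.pow _)

/-- The curve pair is jointly analytic in `(t, X, Y)` at every `(t₀, θ′)` with `θ′` off the cut. -/
theorem analyticAt_curveΦ {K₁ K₂ : ℕ} (G₁ : Fin (K₁ + 1) → MvPolynomial (Fin 3) ℤ)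
    (G₂ : Fin (K₂ + 1) → MvPolynomial (Fin 3) ℤ) (t₀ : ℂ) {X₀ Y₀ : ℂ} (hX : X₀ ∈ Complex.slitPlane)
    (hY : Y₀ ∈ Complex.slitPlane) : AnalyticAt ℂ (Function.uncurry (curveΦ G₁ G₂)) (t₀, (X₀, Y₀)) :=
  (analyticAt_relEval_fst G₁ (z := (t₀, (X₀, Y₀))) hX).prod (analyticAt_relEval_snd G₂ (z := (t₀, (X₀, Y₀))) hY)

/-- `IsolatedAt'` (the box form) ⟹ `θ′` is an isolated point of the zero set of `Φ_ρ` (the filter form A wants). -/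
theorem eventually_ne_of_isolatedAt' {ρ : ℝ} {X₀ Y₀ : ℂ} {K₁ K₂ : ℕ} {G₁ : Fin (K₁ + 1) → MvPolynomial (Fin 3) ℤ}
    {G₂ : Fin (K₂ + 1) → MvPolynomial (Fin 3) ℤ} (h : IsolatedAt' ρ X₀ Y₀ G₁ G₂) :
    ∀ᶠ w in 𝓝[≠] (X₀, Y₀), curveΦ G₁ G₂ ρ w ≠ 0 := by
  obtain ⟨ε, hε, hiso⟩ := h
  have hball : Metric.ball (X₀, Y₀) ε ∈ 𝓝 (X₀, Y₀) := Metric.ball_mem_nhds _ hε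
  filter_upwards [mem_nhdsWithin_of_mem_nhds hball, self_mem_nhdsWithin] with w hw hne
  intro h0
  apply hne
  have hw' : ‖w - (X₀, Y₀)‖ < ε := by rwa [Metric.mem_ball, dist_eq_norm] at hw
  have h1 : ‖w.1 - X₀‖ < ε := lt_of_le_of_lt (by simpa using norm_fst_le (w - (X₀, Y₀))) hw'
  have h2 : ‖w.2 - Y₀‖ < ε := lt_of_le_of_lt (by simpa using norm_snd_le (w - (X₀, Y₀))) hw'
  simp only [curveΦ, Prod.mk_eq_zero] at h0
  have hc := hiso w.1 w.2 h1 h2 h0.1 h0.2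
  exact Prod.ext hc.1 hc.2

/-- **A at work (PROVED mod A), base-point-general:** at an isolated intersection lying on both curves, off the
cut, the common zero MOVES analytically-controlled in `t` and stays isolated. -/
theorem movingZero_of_A (hA : AnalyticMovingZero) {ρ : ℝ} {X₀ Y₀ : ℂ} (hX : X₀ ∈ Complex.slitPlane)
    (hY : Y₀ ∈ Complex.slitPlane) {K₁ K₂ : ℕ} {G₁ : Fin (K₁ + 1) → MvPolynomial (Fin 3) ℤ}
    {G₂ : Fin (K₂ + 1) → MvPolynomial (Fin 3) ℤ} (h0 : curveΦ G₁ G₂ ρ (X₀, Y₀) = 0)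
    (hiso : IsolatedAt' ρ X₀ Y₀ G₁ G₂) :
    ∃ δ C κ : ℝ, 0 < δ ∧ 0 < C ∧ 0 < κ ∧ ∀ t : ℂ, ‖t - ρ‖ < δ →
      ∃ w : ℂ × ℂ, curveΦ G₁ G₂ t w = 0 ∧ (∀ᶠ w' in 𝓝[≠] w, curveΦ G₁ G₂ t w' ≠ 0) ∧
        ‖w - (X₀, Y₀)‖ ≤ C * ‖t - ρ‖ ^ κ :=
  hA (curveΦ G₁ G₂) ρ (X₀, Y₀) (analyticAt_curveΦ G₁ G₂ ρ hX hY) h0 (eventually_ne_of_isolatedAt' hiso)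

/-- `θ = (e, e^i)` lies on both curves of a relation pair. -/
theorem curveΦ_theta_eq_zero {ρ : ℝ} {K₁ K₂ : ℕ} {G₁ : Fin (K₁ + 1) → MvPolynomial (Fin 3) ℤ}
    {G₂ : Fin (K₂ + 1) → MvPolynomial (Fin 3) ℤ} (h : IsRelationPair ρ G₁ G₂) :
    curveΦ G₁ G₂ ρ (cexp 1, cexp Complex.I) = 0 := by
  obtain ⟨h1, h2⟩ := base_mem_curves ρ h
  simp only [curveΦ, Prod.mk_eq_zero]
  exact ⟨h1, h2⟩

/-- **THE MOVING ZERO at θ (PROVED mod A):** for every relation pair with an isolated intersection at `(e, e^i)`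
there are `δ, C, κ > 0` such that for every `t` with `|t − ρ| < δ` the `t`-curves have a common zero `w_t`, isolated,
with `‖w_t − (e, e^i)‖ ≤ C |t − ρ|^κ` — the analytic half of M′; pinning + B turn `w_{p/q}` into `ApproxData`. -/
theorem movingZero_theta (hA : AnalyticMovingZero) {ρ : ℝ} {K₁ K₂ : ℕ} {G₁ : Fin (K₁ + 1) → MvPolynomial (Fin 3) ℤ}
    {G₂ : Fin (K₂ + 1) → MvPolynomial (Fin 3) ℤ} (hP : IsRelationPair ρ G₁ G₂) (hiso : IsolatedAt ρ G₁ G₂) :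
    ∃ δ C κ : ℝ, 0 < δ ∧ 0 < C ∧ 0 < κ ∧ ∀ t : ℂ, ‖t - ρ‖ < δ →
      ∃ w : ℂ × ℂ, curveΦ G₁ G₂ t w = 0 ∧ (∀ᶠ w' in 𝓝[≠] w, curveΦ G₁ G₂ t w' ≠ 0) ∧
        ‖w - (cexp 1, cexp Complex.I)‖ ≤ C * ‖t - ρ‖ ^ κ :=
  movingZero_of_A hA exp_one_mem_slitPlane exp_I_mem_slitPlane (curveΦ_theta_eq_zero hP)
    ((isolatedAt_iff_isolatedAt' ρ G₁ G₂).1 hiso)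

end PieceA

/-! ## §A⁺  SUB-PIECE A PROVED modulo TWO print facts (lens-4 g35 `MovingZeroPieceA.lean` 8899dedb…, Facts + Proof verbatim;
its character-identical copy of `AnalyticMovingZero` dropped — the definition above is used). -/

section PieceAProof

open Complex Filter Topology Metric

section Facts

/-- **FACT A1 — Rouché for holomorphic maps of the bidisc (multiplicity-free corollary, with finiteness).**
[cite: Chirka1989, §10.3 Theorem 1, p. 124 (D = the sup-norm ball, a bounded domain); finiteness of the zero sets: §3.3
Proposition 1, p. 44; μ_a ≥ 1: §10.2, p. 120]
[corpus: book:chirkand-complex-analytic-sets p0124, p0044, p0120] -/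
def RoucheMaps : Prop :=
  ∀ (f g : ℂ × ℂ → ℂ × ℂ) (w₀ : ℂ × ℂ) (r : ℝ), 0 < r →
    AnalyticOnNhd ℂ f (closedBall w₀ r) → AnalyticOnNhd ℂ g (closedBall w₀ r) → f w₀ = 0 →
      (∀ w ∈ sphere w₀ r, ‖f w - g w‖ < ‖f w‖) →
        (∃ w ∈ ball w₀ r, g w = 0) ∧ {w ∈ ball w₀ r | g w = 0}.Finite

/-- **FACT A2 — power lower bound at an isolated zero (Łojasiewicz / local Nullstellensatz).**
[cite: DAngeloSCV1993, Ch. 2 Theorem 1 (8), eq. (66), p. 59: h^{D(f)} ∈ (f) for every h in the maximal ideal, f a finite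
analytic map germ]
[corpus: book:d-angelo2019-several-complex-variables-geometry-real-hypersurfaces p0059] -/
def IsolatedZeroLowerBound : Prop :=
  ∀ (f : ℂ × ℂ → ℂ × ℂ) (w₀ : ℂ × ℂ), AnalyticAt ℂ f w₀ → f w₀ = 0 → (∀ᶠ w in 𝓝[≠] w₀, f w ≠ 0) →
    ∃ (c : ℝ) (N : ℕ), 0 < c ∧ ∀ᶠ w in 𝓝 w₀, c * ‖w - w₀‖ ^ N ≤ ‖f w‖

/-- Non-vacuity of the typing of FACT A1: hypotheses satisfiable and conclusion true for `f = g = w ↦ w − w₀`. -/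
theorem roucheMaps_example (w₀ : ℂ × ℂ) :
    (AnalyticOnNhd ℂ (fun w : ℂ × ℂ => w - w₀) (closedBall w₀ 1) ∧ (fun w : ℂ × ℂ => w - w₀) w₀ = 0 ∧
      ∀ w ∈ sphere w₀ (1 : ℝ), ‖(w - w₀) - (w - w₀)‖ < ‖w - w₀‖) ∧
    ((∃ w ∈ ball w₀ (1 : ℝ), w - w₀ = 0) ∧ {w ∈ ball w₀ (1 : ℝ) | w - w₀ = 0}.Finite) := by
  refine ⟨⟨fun w _ => analyticAt_id.sub analyticAt_const, sub_self w₀, fun w hw => ?_⟩,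
    ⟨w₀, mem_ball_self one_pos, sub_self w₀⟩, ?_⟩
  · rw [mem_sphere, dist_eq_norm] at hw
    rw [sub_self, norm_zero, hw]
    exact one_pos
  · exact (Set.finite_singleton w₀).subset fun w hw => by simpa [sub_eq_zero] using hw.2

/-- Non-vacuity of the typing of FACT A2 (`f = w ↦ w − w₀`, `c = 1`, `N = 1`). -/
theorem isolatedZeroLowerBound_example (w₀ : ℂ × ℂ) :
    (AnalyticAt ℂ (fun w : ℂ × ℂ => w - w₀) w₀ ∧ (fun w : ℂ × ℂ => w - w₀) w₀ = 0 ∧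
      ∀ᶠ w in 𝓝[≠] w₀, w - w₀ ≠ 0) ∧
    ∃ (c : ℝ) (N : ℕ), 0 < c ∧ ∀ᶠ w in 𝓝 w₀, c * ‖w - w₀‖ ^ N ≤ ‖w - w₀‖ := by
  refine ⟨⟨analyticAt_id.sub analyticAt_const, sub_self w₀, ?_⟩, 1, 1, one_pos, ?_⟩
  · exact eventually_nhdsWithin_of_forall fun w hw => sub_ne_zero.mpr hw
  · exact Eventually.of_forall fun w => by simp

end Facts

section Proof

/-- Joint analyticity ⟹ analyticity of each slice `Φ t` (as a map of `w`). -/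
theorem analyticAt_slice {Φ : ℂ → ℂ × ℂ → ℂ × ℂ} {t : ℂ} {w : ℂ × ℂ}
    (h : AnalyticAt ℂ (Function.uncurry Φ) (t, w)) : AnalyticAt ℂ (Φ t) w := by
  have h2 : AnalyticAt ℂ (fun w' : ℂ × ℂ => (t, w')) w := analyticAt_const.prod analyticAt_id
  have h3 := h.comp h2
  simpa [Function.comp_def] using h3

/-- **A PROVED modulo FACTS A1, A2.**  See the module docstring for the proof. -/
theorem analyticMovingZero_of_facts (hR : RoucheMaps) (hL : IsolatedZeroLowerBound) : AnalyticMovingZero := by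
  intro Φ t₀ w₀ han h0 hiso
  -- (1) joint analyticity on a ball, (2) a joint Lipschitz constant near `(t₀, w₀)`
  obtain ⟨ρ₀, hρ₀, hanOn⟩ := han.exists_ball_analyticOnNhd
  obtain ⟨K, s, hs, hLip⟩ := (han.contDiffAt (n := 1)).exists_lipschitzOnWith
  obtain ⟨ρ₁, hρ₁, hball₁⟩ := Metric.mem_nhds_iff.mp hs
  -- (3) the power lower bound for the slice `Φ t₀`
  obtain ⟨c, N, hc, hlow⟩ := hL (Φ t₀) w₀ (analyticAt_slice han) h0 hiso
  obtain ⟨ρ₂, hρ₂, hball₂⟩ := Metric.eventually_nhds_iff_ball.mp hlow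
  have hN : N ≠ 0 := by
    intro hN0
    have h := hball₂ w₀ (mem_ball_self hρ₂)
    rw [hN0, pow_zero, mul_one, h0, norm_zero] at h
    exact absurd h (not_le.mpr hc)
  have hNr : (N : ℝ) ≠ 0 := Nat.cast_ne_zero.mpr hN
  have hNpos : (0 : ℝ) < N := Nat.cast_pos.mpr (Nat.pos_of_ne_zero hN)
  -- radii and constants
  set ρ : ℝ := min ρ₀ (min ρ₁ ρ₂) with hρdef
  have hρ : 0 < ρ := lt_min hρ₀ (lt_min hρ₁ hρ₂)
  have hρ₀' : ρ ≤ ρ₀ := min_le_left _ _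
  have hρ₁' : ρ ≤ ρ₁ := (min_le_right _ _).trans (min_le_left _ _)
  have hρ₂' : ρ ≤ ρ₂ := (min_le_right _ _).trans (min_le_right _ _)
  set L : ℝ := (K : ℝ) + 1 with hLdef
  have hK0 : (0 : ℝ) ≤ K := K.coe_nonneg
  have hL : 0 < L := by rw [hLdef]; linarith
  set R : ℝ := ρ / 2 with hRdef
  have hRpos : 0 < R := by rw [hRdef]; linarith
  set δ₀ : ℝ := c * R ^ N / (2 * L) with hδ₀def
  have hδ₀ : 0 < δ₀ := by rw [hδ₀def]; positivity
  refine ⟨min (ρ / 2) δ₀, (2 * L / c) ^ (1 / (N : ℝ)), 1 / (N : ℝ), lt_min (by linarith) hδ₀,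
    Real.rpow_pos_of_pos (by positivity) _, one_div_pos.mpr hNpos, ?_⟩
  intro t ht
  have ht₁ : ‖t - t₀‖ < ρ / 2 := lt_of_lt_of_le ht (min_le_left _ _)
  have ht₂ : ‖t - t₀‖ < δ₀ := lt_of_lt_of_le ht (min_le_right _ _)
  by_cases htt : t = t₀
  · subst htt
    refine ⟨w₀, h0, hiso, ?_⟩
    rw [sub_self, norm_zero, sub_self, norm_zero, Real.zero_rpow (one_div_ne_zero hNr), mul_zero]
  have htpos : 0 < ‖t - t₀‖ := norm_pos_iff.mpr (sub_ne_zero.mpr htt)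
  -- the Rouché radius
  set r : ℝ := (2 * L / c * ‖t - t₀‖) ^ (1 / (N : ℝ)) with hrdef
  have hbase : 0 < 2 * L / c * ‖t - t₀‖ := by positivity
  have hr : 0 < r := Real.rpow_pos_of_pos hbase _
  have hrN : r ^ N = 2 * L / c * ‖t - t₀‖ := by
    rw [hrdef, ← Real.rpow_natCast, ← Real.rpow_mul hbase.le, one_div_mul_cancel hNr, Real.rpow_one]
  have hrR : r ≤ R := by
    refine le_of_pow_le_pow_left₀ hN hRpos.le ?_
    rw [hrN]
    have h1 : 2 * L / c * ‖t - t₀‖ ≤ 2 * L / c * δ₀ :=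
      mul_le_mul_of_nonneg_left ht₂.le (by positivity)
    have h2 : 2 * L / c * δ₀ = R ^ N := by
      rw [hδ₀def]
      field_simp
    linarith
  have hrρ : r < ρ := by linarith
  -- analyticity of the slices on the closed ball of radius `r`
  have hA : ∀ t' : ℂ, ‖t' - t₀‖ < ρ / 2 → AnalyticOnNhd ℂ (Φ t') (closedBall w₀ r) := by
    intro t' ht' w hw
    rw [mem_closedBall, dist_eq_norm] at hw
    refine analyticAt_slice (hanOn _ ?_)
    rw [mem_ball, Prod.dist_eq, dist_eq_norm, dist_eq_norm]
    exact max_lt (by linarith) (by linarith)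
  -- the strict Rouché inequality on the sphere `‖w − w₀‖ = r`
  have hsph : ∀ w ∈ sphere w₀ r, ‖Φ t₀ w - Φ t w‖ < ‖Φ t₀ w‖ := by
    intro w hw
    rw [mem_sphere, dist_eq_norm] at hw
    -- lower bound at `t₀`
    have hlo : c * r ^ N ≤ ‖Φ t₀ w‖ := by
      have h := hball₂ w (by rw [mem_ball, dist_eq_norm, hw]; linarith)
      rwa [hw] at h
    have hlo' : 2 * L * ‖t - t₀‖ ≤ ‖Φ t₀ w‖ := by
      rw [hrN] at hlo
      have : c * (2 * L / c * ‖t - t₀‖) = 2 * L * ‖t - t₀‖ := by field_simp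
      linarith
    -- Lipschitz upper bound for the variation in `t`
    have hmem₀ : (t₀, w) ∈ s := hball₁ (by
      rw [mem_ball, Prod.dist_eq, dist_self, dist_eq_norm, hw]
      exact max_lt hρ₁ (by linarith))
    have hmem : (t, w) ∈ s := hball₁ (by
      rw [mem_ball, Prod.dist_eq, dist_eq_norm, dist_eq_norm, hw]
      exact max_lt (by linarith) (by linarith))
    have hup : ‖Φ t₀ w - Φ t w‖ ≤ K * ‖t - t₀‖ := by
      have h := hLip.dist_le_mul (t₀, w) hmem₀ (t, w) hmem
      rw [dist_eq_norm, Prod.dist_eq, dist_self, dist_eq_norm, max_eq_left (norm_nonneg _),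
        norm_sub_rev t₀ t] at h
      simpa [Function.uncurry] using h
    calc ‖Φ t₀ w - Φ t w‖ ≤ K * ‖t - t₀‖ := hup
      _ < 2 * L * ‖t - t₀‖ := mul_lt_mul_of_pos_right (by rw [hLdef]; linarith) htpos
      _ ≤ ‖Φ t₀ w‖ := hlo'
  -- Rouché: a zero of `Φ t` in the ball, and finitely many there
  obtain ⟨⟨w, hwB, hw0⟩, hfin⟩ := hR (Φ t₀) (Φ t) w₀ r hr (hA t₀ (by simpa using half_pos hρ)) (hA t ht₁) h0 hsph
  refine ⟨w, hw0, ?_, ?_⟩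
  · -- isolated, since the zeros of `Φ t` in the open ball are finite
    have hopen : IsOpen (ball w₀ r \ ({w' ∈ ball w₀ r | Φ t w' = 0} \ {w})) :=
      isOpen_ball.sdiff (hfin.subset fun x hx => hx.1).isClosed
    have hmemw : w ∈ ball w₀ r \ ({w' ∈ ball w₀ r | Φ t w' = 0} \ {w}) := ⟨hwB, fun h => h.2 rfl⟩
    have hev : ∀ᶠ w' in 𝓝 w, w' ∈ ball w₀ r \ ({w' ∈ ball w₀ r | Φ t w' = 0} \ {w}) := hopen.mem_nhds hmemw
    filter_upwards [eventually_nhdsWithin_of_eventually_nhds hev, self_mem_nhdsWithin] with w' h1 h2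
    intro hzero
    exact h1.2 ⟨⟨h1.1, hzero⟩, h2⟩
  · -- the Hölder rate
    have hlt : ‖w - w₀‖ < r := by rwa [mem_ball, dist_eq_norm] at hwB
    rw [hrdef, Real.mul_rpow (by positivity) (norm_nonneg _)] at hlt
    exact hlt.le

end Proof

end PieceAProof

end G03part

end Summit.Schanuel.Schanuel.Theorems.RootDecomp1BMovingZero

end
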